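import Mathlib.Analysis.SpecialFunctions.Complex.LogDeriv
import Mathlib.Analysis.SpecialFunctions.Complex.Analytic
import HarnessLib

/-!
# The phase and amplitude of Zudilin's linear forms (saddle-point data of [Zudilin2004, Thm. 3])

Topic `Literature/NumberTheory/Transcendental`. This file fixes, as real DEFINITIONS, the
elementary functions governing the asymptotics of Zudilin's linear forms
`Sₙ = ½ Σ_k Rₙ''(k)` in `1, ζ(5), ζ(7), ζ(9), ζ(11)` ([Zudilin2004, §8, Lemma 20 and the proof of
Theorem 3]; the rational function `Rₙ` is `Literature.NumberTheory.Transcendental.Zudilin2004.R`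
of `ZudilinOddZeta.lean`, in Fischler's variable `k`), and proves their basic differentiability.
No named fact is introduced; the file is sorry-free.

Writing `k = nκ`, Stirling's formula for the factorials in the normalising constant and the
first-order Euler–Maclaurin formula for the Pochhammer blocks of `Rₙ` give, uniformly on compact
subsets of the open upper half-plane,

  `Rₙ(nκ) = exp(n ψ(κ) + A(κ) + o(1)) · n⁻⁷`,

with the **phase** `ψ = Zudilin2004.psiR` and the **amplitude** `A = Zudilin2004.amp` below;
the kernel `sinh(πy)/cosh³(πy) ~ 4 e^{−2πy}` of the Barnes integral for `Sₙ` along the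
half-integer line `re k = ⌊x₀ n⌋ + ½` contributes `e^{2πik}` up to sign, whence the total phase
`Φ(κ) = ψ(κ) + 2πiκ` (`Zudilin2004.phase`) and the saddle-point equation
`Φ'(κ) = 0` (`Zudilin2004.dphase κ = 0`), i.e. after exponentiation the polynomial equation
`κ³(κ+64)³ ∏_u (κ+12−u) = (κ−27)³(κ+37)³ ∏_u (κ+25+u)` of [Zudilin2004, Lemma 20]
(`(τ−η₀)^r ∏(τ−ηⱼ) = τ^r ∏(τ−η₀+ηⱼ)` in the variable `τ = 91 − κ̄`… of the source; numerically
`κ₀ = 23.47900541… + 3.32820690… i = 91 − τ̄₀` with `τ₀ = 87.47900541… + 3.32820690… i` as printed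
in the proof of Theorem 3, and `Re Φ(κ₀) = −C₀ = −227.58019641…`).

* `Zudilin2004.blockInt κ a b = L(κ+b) − L(κ+a)`, `L(z) = z log z − z` — the integral
  `∫_a^b log(κ + x) dx` of a Pochhammer block;
* `Zudilin2004.psiR`, `Zudilin2004.phase`, `Zudilin2004.dphase`, `Zudilin2004.amp`;
* `Zudilin2004.saddle` — *a* zero of `dphase` in the box `|re κ − 23.479| ≤ 1/100`,
  `|im κ − 3.328| ≤ 1/100`, chosen by `Classical.epsilon` (its existence, with a much finer
  enclosure, is proved in the numerical companion file; until then nothing is claimed about it);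
  `Zudilin2004.x0 = re saddle`, `Zudilin2004.u0 = im saddle`.
* `hasDerivAt_blockInt`, `hasDerivAt_psiR`, `hasDerivAt_phase` — `Φ' = dphase` on the open upper
  half-plane.

## References

* [Zudilin2004] W. Zudilin, *Arithmetic of linear forms involving odd zeta values*, J. Théor.
  Nombres Bordeaux 16 (2004), 251–291 (arXiv:math/0206176), §8, Lemma 20, Prop. 5, Thm. 3.
* [Zudilin2002] W. Zudilin, *Irrationality of values of the Riemann zeta function*, Izv. Math. 66
  (2002), 489–542, §4 (Lemmas 3–6: the shape `e^{n f(τ)} g(τ)` of the integrand).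
-/

noncomputable section

open Complex Finset

namespace Literature.NumberTheory.Transcendental

namespace Zudilin2004

/-! ### The block integral `∫_a^b log(κ + x) dx` -/

/-- `L(κ + b) − L(κ + a)` with `L(z) = z log z − z` (principal branch): for `im κ ≠ 0` this is
`∫_a^b log(κ + x) dx`, the continuum limit of `(1/n) Σ log(κ + i/n)` over a Pochhammer block.
[cite: Zudilin2002, §4 Lemma 3] -/
def blockInt (κ : ℂ) (a b : ℝ) : ℂ :=
  ((κ + b) * log (κ + b) - (κ + b)) - ((κ + a) * log (κ + a) - (κ + a))

/-- **The phase `ψ` of `Rₙ(nκ)`**: `ψ(κ) = 3 ∫_{−27}^0 log(κ+x) dx + 3 ∫_{37}^{64} log(κ+x) dx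
− Σ_{u=1}^{10} ∫_{12−u}^{25+u} log(κ+x) dx + C₁`, where
`C₁ = Σ_u ((13+2u) log(13+2u) − (13+2u)) − 6 (27 log 27 − 27)` is the exponential rate of the
normalising constant `∏_u ((13+2u)n)!/(27n)!⁶`. Then `(1/n) log |Rₙ(nκ)| → Re ψ(κ)`.
[cite: Zudilin2004, §8 Lemma 20] -/
def psiR (κ : ℂ) : ℂ :=
  3 * blockInt κ (-27) 0 + 3 * blockInt κ 37 64 -
    (∑ u ∈ Icc (1 : ℕ) 10, blockInt κ (12 - (u : ℝ)) (25 + (u : ℝ))) +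
    ((∑ u ∈ Icc (1 : ℕ) 10, ((13 + 2 * (u : ℝ)) * Real.log (13 + 2 * (u : ℝ)) - (13 + 2 * (u : ℝ))) -
      6 * (27 * Real.log 27 - 27) : ℝ) : ℂ)

/-- **The total phase** `Φ(κ) = ψ(κ) + 2πiκ` of the integrand `Rₙ(nκ) · sinh/cosh³(π n im κ)` of
the Barnes integral for `Sₙ` (the kernel is `∓4 e^{2πik}(1 + o(1))` on half-integer lines).
[cite: Zudilin2004, §8 Lemma 20] -/
def phase (κ : ℂ) : ℂ :=
  psiR κ + 2 * Real.pi * I * κ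

/-- The derivative of the phase, written out:
`Φ'(κ) = 3 log κ − 3 log(κ−27) + 3 log(κ+64) − 3 log(κ+37) − Σ_u (log(κ+25+u) − log(κ+12−u)) + 2πi`.
Its zeros are the saddle points; exponentiating, `κ³(κ+64)³∏(κ+12−u) = (κ−27)³(κ+37)³∏(κ+25+u)`.
[cite: Zudilin2004, §8 Lemma 20] -/
def dphase (κ : ℂ) : ℂ :=
  3 * log κ - 3 * log (κ - 27) + 3 * log (κ + 64) - 3 * log (κ + 37) -
    (∑ u ∈ Icc (1 : ℕ) 10, (log (κ + 25 + (u : ℂ)) - log (κ + 12 - (u : ℂ)))) + 2 * Real.pi * I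

/-- **The amplitude** `A(κ)` in `Rₙ(nκ) = n⁻⁷ exp(nψ(κ) + A(κ) + o(1))`: the half-weights of the
endpoints of the blocks (trapezoid rule), the factor `37n + 2k = n(37 + 2κ)`, and Stirling's
constants `½ log(2πN)` of the factorials:
`A(κ) = log(37+2κ) + (3/2)(log(κ−27) − log κ) + (3/2)(log(κ+64) − log(κ+37))
 − ½ Σ_u (log(κ+12−u) + log(κ+25+u)) + ½ Σ_u log(2π(13+2u)) − 3 log(54π)`.
[cite: Zudilin2002, §4 Lemma 3] -/
def amp (κ : ℂ) : ℂ :=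
  log (37 + 2 * κ) + 3 / 2 * (log (κ - 27) - log κ) + 3 / 2 * (log (κ + 64) - log (κ + 37)) -
    1 / 2 * (∑ u ∈ Icc (1 : ℕ) 10, (log (κ + 12 - (u : ℂ)) + log (κ + 25 + (u : ℂ)))) +
    ((1 / 2 * ∑ u ∈ Icc (1 : ℕ) 10, Real.log (2 * Real.pi * (13 + 2 * (u : ℝ))) -
      3 * Real.log (54 * Real.pi) : ℝ) : ℂ)

/-- The box `|re κ − 23.479| ≤ 1/100`, `|im κ − 3.328| ≤ 1/100` around the relevant saddle point
`κ₀ = 23.47900541… + 3.32820690… i` (`= 91 − 87.47900541… + 3.32820690… i` in the variable of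
the source). [cite: Zudilin2004, §8 proof of Thm. 3] -/
def saddleBox : Set ℂ :=
  {κ : ℂ | |κ.re - 23479 / 1000| ≤ 1 / 100 ∧ |κ.im - 3328 / 1000| ≤ 1 / 100}

/-- **The saddle point**: some zero of `dphase` in `saddleBox`, chosen once and for all
(`Classical.epsilon`; the existence of such a zero — indeed within `10⁻⁶` of
`23.4790054 + 3.3282069 i` — is a numerical theorem proved separately, after which
`saddle ∈ saddleBox ∧ dphase saddle = 0`). [cite: Zudilin2004, §8 Lemma 20] -/
def saddle : ℂ :=
  Classical.epsilon fun κ : ℂ ↦ κ ∈ saddleBox ∧ dphase κ = 0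

/-- The abscissa `x₀ = re κ₀` of the line of integration `re k = ⌊x₀ n⌋ + ½`.
[cite: Zudilin2004, §8 Lemma 20] -/
def x0 : ℝ := saddle.re

/-- The ordinate `u₀ = im κ₀` of the saddle point on that line. [cite: Zudilin2004, §8 Lemma 20] -/
def u0 : ℝ := saddle.im

/-! ### Differentiability -/

/-- If the defining predicate is satisfiable, `saddle` satisfies it. [folklore] -/
theorem saddle_spec (h : ∃ κ : ℂ, κ ∈ saddleBox ∧ dphase κ = 0) :
    saddle ∈ saddleBox ∧ dphase saddle = 0 :=
  Classical.epsilon_spec h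

/-- `z log z − z` has derivative `log z` on the slit plane. [folklore] -/
theorem hasDerivAt_mul_log_sub {z : ℂ} (hz : z ∈ slitPlane) :
    HasDerivAt (fun w : ℂ ↦ w * log w - w) (log z) z := by
  have h1 : HasDerivAt (fun w : ℂ ↦ w * log w) (1 * log z + z * z⁻¹) z :=
    (hasDerivAt_id z).mul (Complex.hasDerivAt_log hz)
  refine (h1.sub (hasDerivAt_id z)).congr_deriv ?_
  have hz0 : z ≠ 0 := slitPlane_ne_zero hz
  field_simp
  ring

/-- In the open upper half-plane, `κ + x ∈ slitPlane` for real `x`. [folklore] -/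
theorem add_real_mem_slitPlane {κ : ℂ} (hκ : 0 < κ.im) (x : ℝ) : κ + x ∈ slitPlane :=
  Or.inr (by simp [hκ.ne'])

/-- `∂/∂κ blockInt κ a b = log(κ + b) − log(κ + a)` on the upper half-plane. [folklore] -/
theorem hasDerivAt_blockInt {κ : ℂ} (hκ : 0 < κ.im) (a b : ℝ) :
    HasDerivAt (fun w : ℂ ↦ blockInt w a b) (log (κ + b) - log (κ + a)) κ := by
  unfold blockInt
  have h : ∀ c : ℝ, HasDerivAt (fun w : ℂ ↦ (w + c) * log (w + c) - (w + c)) (log (κ + c)) κ :=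
    fun c ↦ (hasDerivAt_mul_log_sub (add_real_mem_slitPlane hκ c)).comp_add_const κ (c : ℂ)
  exact (h b).sub (h a)

/-- `ψ' (κ) = dphase κ − 2πi` on the upper half-plane. [cite: Zudilin2004, §8 Lemma 20] -/
theorem hasDerivAt_psiR {κ : ℂ} (hκ : 0 < κ.im) :
    HasDerivAt psiR (dphase κ - 2 * Real.pi * I) κ := by
  have h1 := (hasDerivAt_blockInt hκ (-27) 0).const_mul (3 : ℂ)
  have h2 := (hasDerivAt_blockInt hκ 37 64).const_mul (3 : ℂ)
  have h3 : HasDerivAt (fun w : ℂ ↦ ∑ u ∈ Icc (1 : ℕ) 10, blockInt w (12 - (u : ℝ)) (25 + (u : ℝ)))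
      (∑ u ∈ Icc (1 : ℕ) 10, (log (κ + ((25 + (u : ℝ) : ℝ) : ℂ)) - log (κ + ((12 - (u : ℝ) : ℝ) : ℂ))))
      κ :=
    HasDerivAt.fun_sum fun u _ ↦ hasDerivAt_blockInt hκ (12 - (u : ℝ)) (25 + (u : ℝ))
  have h4 : HasDerivAt (fun _ : ℂ ↦ (((∑ u ∈ Icc (1 : ℕ) 10, ((13 + 2 * (u : ℝ)) *
      Real.log (13 + 2 * (u : ℝ)) - (13 + 2 * (u : ℝ)))) - 6 * (27 * Real.log 27 - 27) : ℝ) : ℂ))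
      0 κ := hasDerivAt_const κ _
  have h := ((h1.add h2).sub h3).add h4
  have hfun : psiR = fun w ↦ 3 * blockInt w (-27) 0 + 3 * blockInt w 37 64 -
      (∑ u ∈ Icc (1 : ℕ) 10, blockInt w (12 - (u : ℝ)) (25 + (u : ℝ))) +
      (((∑ u ∈ Icc (1 : ℕ) 10, ((13 + 2 * (u : ℝ)) * Real.log (13 + 2 * (u : ℝ)) -
        (13 + 2 * (u : ℝ)))) - 6 * (27 * Real.log 27 - 27) : ℝ) : ℂ) := by
    funext w; rfl
  rw [hfun]
  refine h.congr_deriv ?_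
  unfold dphase
  have hcast : ∀ u ∈ Icc (1 : ℕ) 10,
      log (κ + ((25 + (u : ℝ) : ℝ) : ℂ)) - log (κ + ((12 - (u : ℝ) : ℝ) : ℂ)) =
      log (κ + 25 + (u : ℂ)) - log (κ + 12 - (u : ℂ)) := by
    intro u _
    push_cast
    ring_nf
  rw [sum_congr rfl hcast]
  push_cast
  ring

/-- **`Φ'(κ) = dphase κ`** on the open upper half-plane. [cite: Zudilin2004, §8 Lemma 20] -/
theorem hasDerivAt_phase {κ : ℂ} (hκ : 0 < κ.im) : HasDerivAt phase (dphase κ) κ := by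
  unfold phase
  have h := (hasDerivAt_psiR hκ).add (((hasDerivAt_id κ).const_mul (2 * Real.pi * I)))
  refine h.congr_deriv ?_
  simp

end Zudilin2004

end Literature.NumberTheory.Transcendental
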